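import Mathlib

/-!
# Single-triad linear algebra for the classification of block-diagonal quadratic Casimirs

Helper file for stub `stub_diagonalClassification` (S3b) of the line `farkas-split-menu` of crux
`MomentParity.CubicParityLoud`: the REAL three-dimensional linear algebra behind one resonant
triad `a + b = c` of frequencies.  After reduction of a block-diagonal Casimir kernel to its
effective real blocks — a symmetric compressed matrix `M k` (`M k *ᵥ k = 0`) and a scalar
`λ k` per frequency — the cubic Casimir identity evaluated at three elementary plane waves gives,
for all real test amplitudes `u_a ⊥ a`, `u_b ⊥ b`, `u_c ⊥ c`, the SYMMETRIC triad identity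
`Γ_a ⬝ M_a u_a + Γ_b ⬝ M_b u_b + Γ_c ⬝ M_c u_c = 0` and the ANTISYMMETRIC one
`λ_a Γ_a ⬝ (a × u_a) + λ_b Γ_b ⬝ (b × u_b) − λ_c Γ_c ⬝ (c × u_c) = 0`, with the couplings
`Γ_a = (u_c·b) u_b − (u_b·a) u_c`, `Γ_b = (u_c·a) u_a − (u_a·b) u_c`, `Γ_c = (u_a·b) u_b + (u_b·a) u_a`.
This file proves: the isolation-rank lemma (couplings span `c^⊥` when `|a| ≠ |b|`), detailed
energy conservation, the zero/affine propagation of the symmetric blocks along a triad with two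
known legs, the rigidity `λ_a = λ_b = λ_c` of the antisymmetric blocks on every single triad, the
passage from three basis values to the whole compressed block, and the axial representation of a
compressed antisymmetric matrix.  Everything is `Fin 3 → ℝ` with Mathlib's `dotProduct` /
`crossProduct`; no definitions.
-/

namespace Summit.AnomalousDissipation.AnomalousDissipation.Theorems.MomentParityCubicParityLoud

open Matrix

set_option linter.dupNamespace false

/-! ## Reciprocal bases and the isolation-rank lemma (copied from the line skeleton, proved there) -/

/-- A vector orthogonal to `k`, `d` and `k × d` vanishes when `k × d ≠ 0` (Lagrange's identity
`|m × c|² = |m|²|c|² − (m·c)²` with `c = k × d`, and `m × (k × d) = (m·d)k − (m·k)d`). [folklore] -/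
theorem eq_zero_of_perp (k d m : Fin 3 → ℝ) (hkd : crossProduct k d ≠ 0)
    (hk : dotProduct m k = 0) (hd : dotProduct m d = 0) (hc : dotProduct m (crossProduct k d) = 0) :
    m = 0 := by
  have hcc : dotProduct (crossProduct k d) (crossProduct k d) ≠ 0 :=
    fun h0 => hkd (dotProduct_self_eq_zero.1 h0)
  have hcross : crossProduct m (crossProduct k d) = 0 := by
    rw [cross_cross_eq_smul_sub_smul', hd, dotProduct_comm, hk, zero_smul, zero_smul, sub_zero]
  have hlag := cross_dot_cross m (crossProduct k d) m (crossProduct k d)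
  rw [hcross, dotProduct_zero, hc, zero_mul, sub_zero] at hlag
  exact dotProduct_self_eq_zero.1 ((mul_eq_zero.1 hlag.symm).resolve_right hcc)

/-- Reciprocal-basis expansion in `ℝ³`:
`(u·(v×w)) x = (x·(v×w)) u + (x·(w×u)) v + (x·(u×v)) w`. [folklore] -/
theorem triple_decomp (u v w x : Fin 3 → ℝ) :
    (dotProduct u (crossProduct v w)) • x =
      (dotProduct x (crossProduct v w)) • u + (dotProduct x (crossProduct w u)) • v +
        (dotProduct x (crossProduct u v)) • w := by
  simp_rw [cross_apply, vec3_dotProduct]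
  ext i
  fin_cases i <;>
  · simp only [Fin.isValue, Nat.succ_eq_add_one, Nat.reduceAdd, Fin.reduceFinMk, cons_val,
      Pi.add_apply, Pi.smul_apply, smul_eq_mul, Fin.zero_eta, Fin.mk_one, cons_val_zero, cons_val_one]
    ring

/-- **Isolation-rank lemma.**  For real frequencies `a ∦ b` with `|a|² ≠ |b|²`: a vector
`n ⊥ a + b` orthogonal to every `(x·b) y + (y·a) x` (`x ⊥ a`, `y ⊥ b`) — the symmetric
convection coupling of two plane waves — is zero (test pairs `(a×b, b×(a×b))` and
`(a×(a×b), b×(a×b))`). [folklore] -/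
theorem isolationRank (a b n : Fin 3 → ℝ) (hab : crossProduct a b ≠ 0)
    (hnorm : dotProduct a a ≠ dotProduct b b) (hn : dotProduct n (a + b) = 0)
    (h : ∀ x y : Fin 3 → ℝ, dotProduct x a = 0 → dotProduct y b = 0 →
      dotProduct x b * dotProduct n y + dotProduct y a * dotProduct n x = 0) : n = 0 := by
  set c : Fin 3 → ℝ := crossProduct a b with hc
  have hcc : dotProduct c c ≠ 0 := fun h0 => hab (dotProduct_self_eq_zero.1 h0)
  have hca : dotProduct c a = 0 := by rw [hc, dotProduct_comm]; exact dot_self_cross a b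
  have hcb : dotProduct c b = 0 := by rw [hc, dotProduct_comm]; exact dot_cross_self a b
  have hxa : dotProduct (crossProduct a c) a = 0 := by rw [dotProduct_comm]; exact dot_self_cross a c
  have hyb : dotProduct (crossProduct b c) b = 0 := by rw [dotProduct_comm]; exact dot_self_cross b c
  have h_bca : dotProduct (crossProduct b c) a = dotProduct c c := by
    rw [dotProduct_comm, triple_product_permutation, triple_product_permutation]
  have h_acb : dotProduct (crossProduct a c) b = -dotProduct c c := by
    rw [dotProduct_comm, triple_product_permutation, triple_product_permutation, ← cross_anticomm,
      dotProduct_neg]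
  have h1 := h c (crossProduct b c) hca hyb
  rw [hcb, zero_mul, zero_add, h_bca] at h1
  have hnc : dotProduct n c = 0 := (mul_eq_zero.1 h1).resolve_left hcc
  have h2 := h (crossProduct a c) (crossProduct b c) hxa hyb
  rw [h_acb, h_bca] at h2
  have hac : crossProduct a c = (dotProduct a b) • a - (dotProduct a a) • b := by
    rw [hc, cross_cross_eq_smul_sub_smul']
  have hbc : crossProduct b c = (dotProduct b b) • a - (dotProduct a b) • b := by
    rw [hc, cross_cross_eq_smul_sub_smul']
  rw [hac, hbc] at h2
  simp only [dotProduct_sub, dotProduct_smul, smul_eq_mul] at h2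
  rw [dotProduct_add] at hn
  have hkey : dotProduct c c * (dotProduct a a - dotProduct b b) * dotProduct n a = 0 := by
    linear_combination h2 - dotProduct c c * (dotProduct a b - dotProduct a a) * hn
  have hna : dotProduct n a = 0 := by
    rcases mul_eq_zero.1 hkey with h' | h'
    · rcases mul_eq_zero.1 h' with h'' | h''
      · exact absurd h'' hcc
      · exact absurd (sub_eq_zero.1 h'') hnorm
    · exact h'
  have hnb : dotProduct n b = 0 := by linarith
  refine eq_zero_of_perp a b n hab hna hnb ?_
  rw [← hc]; exact hnc

/-! ## Detailed conservation of energy on a triad -/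

/-- **Detailed energy conservation**: the three convection couplings of a triad `a + b = c` do no
total work against the identity blocks, `Γ_a·u_a + Γ_b·u_b + Γ_c·u_c = 0` (it equals
`(u_a·u_b)(u_c·(a+b))`). [folklore] -/
theorem energy_triad (a b c ua ub uc : Fin 3 → ℝ) (habc : a + b = c) (huc : dotProduct uc c = 0) :
    dotProduct ((dotProduct uc b) • ub - (dotProduct ub a) • uc) ua +
      dotProduct ((dotProduct uc a) • ua - (dotProduct ua b) • uc) ub +
      dotProduct ((dotProduct ua b) • ub + (dotProduct ub a) • ua) uc = 0 := by
  rw [← habc, dotProduct_add] at huc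
  simp only [sub_dotProduct, add_dotProduct, smul_dotProduct, smul_eq_mul, dotProduct_comm ub ua,
    dotProduct_comm uc ua, dotProduct_comm uc ub]
  linear_combination (dotProduct ua ub) * huc

/-! ## Compressed symmetric blocks: from basis values to the block, and affine propagation -/

/-- For a symmetric matrix `M` with `M k = 0`, the vector `k` is also killed on the left:
`k ⬝ M w = 0`. [folklore] -/
theorem dotProduct_mulVec_eq_zero_of_symm {M : Matrix (Fin 3) (Fin 3) ℝ} {k : Fin 3 → ℝ}
    (hsymm : M.IsSymm) (hMk : M *ᵥ k = 0) (w : Fin 3 → ℝ) : dotProduct k (M *ᵥ w) = 0 := by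
  rw [dotProduct_mulVec, ← Matrix.mulVec_transpose, hsymm.eq, hMk, zero_dotProduct]

/-- **A compressed symmetric block is isotropic once it is isotropic on an adapted basis.**  If
`M` is symmetric, `M k = 0`, and for some `e ⊥ k` with `k × e ≠ 0` one has
`e ⬝ M e = α |e|²`, `(k×e) ⬝ M e = 0`, `(k×e) ⬝ M (k×e) = α |k×e|²`, then `M w = α w` for every
`w ⊥ k`, hence `u ⬝ M w = α (u ⬝ w)` for all `u`. [folklore] -/
theorem mulVec_eq_smul_of_basis (M : Matrix (Fin 3) (Fin 3) ℝ) (k e : Fin 3 → ℝ) (α : ℝ)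
    (hsymm : M.IsSymm) (hMk : M *ᵥ k = 0) (he : dotProduct e k = 0) (hke : crossProduct k e ≠ 0)
    (h1 : dotProduct e (M *ᵥ e) = α * dotProduct e e)
    (h2 : dotProduct (crossProduct k e) (M *ᵥ e) = 0)
    (h3 : dotProduct (crossProduct k e) (M *ᵥ crossProduct k e) =
      α * dotProduct (crossProduct k e) (crossProduct k e)) :
    ∀ u w : Fin 3 → ℝ, dotProduct w k = 0 → dotProduct u (M *ᵥ w) = α * dotProduct u w := by
  set f : Fin 3 → ℝ := crossProduct k e with hf
  have hek : dotProduct k e = 0 := by rw [dotProduct_comm]; exact he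
  have hfk : dotProduct f k = 0 := by rw [hf, dotProduct_comm]; exact dot_self_cross k e
  have hfe : dotProduct f e = 0 := by rw [hf, dotProduct_comm]; exact dot_cross_self k e
  have hef : dotProduct e f = 0 := by rw [dotProduct_comm]; exact hfe
  -- symmetric values
  have h2' : dotProduct e (M *ᵥ f) = 0 := by
    rw [dotProduct_mulVec, ← Matrix.mulVec_transpose, hsymm.eq, dotProduct_comm]; exact h2
  -- `M e = α e`
  have hMe : M *ᵥ e = α • e := by
    have hz : M *ᵥ e - α • e = 0 := by
      refine eq_zero_of_perp k e _ hke ?_ ?_ ?_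
      · rw [sub_dotProduct, smul_dotProduct, he, smul_zero, sub_zero, dotProduct_comm]
        exact dotProduct_mulVec_eq_zero_of_symm hsymm hMk e
      · rw [sub_dotProduct, smul_dotProduct, smul_eq_mul, dotProduct_comm, h1, sub_self]
      · rw [sub_dotProduct, smul_dotProduct, smul_eq_mul, hef, mul_zero, sub_zero, dotProduct_comm, ← hf, h2]
    exact sub_eq_zero.1 hz
  -- `M f = α f`
  have hMf : M *ᵥ f = α • f := by
    have hz : M *ᵥ f - α • f = 0 := by
      refine eq_zero_of_perp k e _ hke ?_ ?_ ?_
      · rw [sub_dotProduct, smul_dotProduct, hfk, smul_zero, sub_zero, dotProduct_comm]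
        exact dotProduct_mulVec_eq_zero_of_symm hsymm hMk f
      · rw [sub_dotProduct, smul_dotProduct, smul_eq_mul, hfe, mul_zero, sub_zero, dotProduct_comm, h2']
      · rw [← hf, sub_dotProduct, smul_dotProduct, smul_eq_mul, dotProduct_comm, h3, sub_self]
    exact sub_eq_zero.1 hz
  -- decomposition of `w ⊥ k` along `e, f`
  have hD : dotProduct k (crossProduct e f) = dotProduct e e * dotProduct k k := by
    rw [hf, cross_cross_eq_smul_sub_smul', dotProduct_sub, dotProduct_smul, dotProduct_smul, smul_eq_mul,
      smul_eq_mul, hek, zero_mul, sub_zero]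
  have hkk : dotProduct k k ≠ 0 := by
    intro h0
    have : k = 0 := dotProduct_self_eq_zero.1 h0
    apply hke; rw [hf, this, map_zero, LinearMap.zero_apply]
  have hee : dotProduct e e ≠ 0 := by
    intro h0
    have : e = 0 := dotProduct_self_eq_zero.1 h0
    apply hke; rw [hf, this, map_zero]
  have hD0 : dotProduct k (crossProduct e f) ≠ 0 := by rw [hD]; exact mul_ne_zero hee hkk
  intro u w hw
  have hdec := triple_decomp k e f w
  have hwef : dotProduct w (crossProduct e f) = 0 := by
    rw [hf, cross_cross_eq_smul_sub_smul', dotProduct_sub, dotProduct_smul, dotProduct_smul, smul_eq_mul,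
      smul_eq_mul, hw, hek, mul_zero, zero_mul, sub_zero]
  rw [hwef, zero_smul, zero_add] at hdec
  have hMw : (dotProduct k (crossProduct e f)) • (M *ᵥ w) = (dotProduct k (crossProduct e f)) • (α • w) := by
    rw [← Matrix.mulVec_smul, hdec, Matrix.mulVec_add, Matrix.mulVec_smul, Matrix.mulVec_smul, hMe, hMf,
      smul_comm _ α e, smul_comm _ α f, ← smul_add, ← hdec, smul_comm]
  have hMw' : M *ᵥ w = α • w := smul_right_injective _ hD0 hMw
  rw [hMw', dotProduct_smul, smul_eq_mul]

/-- **Affine propagation of the symmetric blocks along a triad with two known legs.**  Let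
`a + b = c` with `a ∦ b`, `|a|² ≠ |b|²`.  If the blocks at `a` and `b` act as `α·id` on
transversal vectors and the symmetric triad identity holds, then the (symmetric, compressed)
block at `c` acts as `α·id` on `c^⊥` as well (isolation-rank lemma applied to `M_c w − α w`,
detailed energy conservation supplying the inhomogeneity). [folklore] -/
theorem propagate_S (a b c : Fin 3 → ℝ) (Ma Mb Mc : Matrix (Fin 3) (Fin 3) ℝ) (α : ℝ)
    (habc : a + b = c) (hab : crossProduct a b ≠ 0) (hnorm : dotProduct a a ≠ dotProduct b b)
    (hsymm : Mc.IsSymm) (hMc : Mc *ᵥ c = 0)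
    (ha : ∀ u w : Fin 3 → ℝ, dotProduct w a = 0 → dotProduct u (Ma *ᵥ w) = α * dotProduct u w)
    (hb : ∀ u w : Fin 3 → ℝ, dotProduct w b = 0 → dotProduct u (Mb *ᵥ w) = α * dotProduct u w)
    (hS : ∀ ua ub uc : Fin 3 → ℝ, dotProduct ua a = 0 → dotProduct ub b = 0 → dotProduct uc c = 0 →
      dotProduct ((dotProduct uc b) • ub - (dotProduct ub a) • uc) (Ma *ᵥ ua) +
        dotProduct ((dotProduct uc a) • ua - (dotProduct ua b) • uc) (Mb *ᵥ ub) +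
        dotProduct ((dotProduct ua b) • ub + (dotProduct ub a) • ua) (Mc *ᵥ uc) = 0) :
    ∀ u w : Fin 3 → ℝ, dotProduct w c = 0 → dotProduct u (Mc *ᵥ w) = α * dotProduct u w := by
  intro u w hw
  set m : Fin 3 → ℝ := Mc *ᵥ w - α • w with hm
  have hwc' : dotProduct w (a + b) = 0 := by rw [habc]; exact hw
  have hm0 : m = 0 := by
    refine isolationRank a b m hab hnorm ?_ ?_
    · rw [hm, sub_dotProduct, smul_dotProduct, smul_eq_mul, hwc', mul_zero, sub_zero, habc, dotProduct_comm]
      exact dotProduct_mulVec_eq_zero_of_symm hsymm hMc w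
    · intro x y hx hy
      have h := hS x y w hx hy hw
      rw [ha _ x hx, hb _ y hy] at h
      simp only [sub_dotProduct, add_dotProduct, smul_dotProduct, smul_eq_mul] at h
      rw [dotProduct_add] at hwc'
      have e1 : dotProduct m y = dotProduct y (Mc *ᵥ w) - α * dotProduct w y := by
        rw [hm, sub_dotProduct, smul_dotProduct, smul_eq_mul, dotProduct_comm]
      have e2 : dotProduct m x = dotProduct x (Mc *ᵥ w) - α * dotProduct w x := by
        rw [hm, sub_dotProduct, smul_dotProduct, smul_eq_mul, dotProduct_comm]
      rw [e1, e2]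
      rw [dotProduct_comm y x] at h
      linear_combination h - α * (dotProduct x y) * hwc'
  have hMw : Mc *ᵥ w = α • w := sub_eq_zero.1 (by rw [← hm]; exact hm0)
  rw [hMw, dotProduct_smul, smul_eq_mul]


/-! ## The antisymmetric blocks: one triad pins all three -/

/-- **Rigidity of the antisymmetric (helicity-type) blocks on a single triad.**  If
`a + b = c`, `a ∦ b`, and the antisymmetric triad identity holds for all transversal real test
amplitudes, then `λ_a = λ_c` and `λ_b = λ_c` (test triples `(a×n, b×n, n)`, `(a×n, n, c×n)`,
`(n, b×n, c×n)` with `n = a × b` give three relations of rank two). [folklore] -/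
theorem triad_A :
    ∀ (a b c : Fin 3 → ℝ) (la lb lc : ℝ), a + b = c → crossProduct a b ≠ 0 →
      (∀ ua ub uc : Fin 3 → ℝ, dotProduct ua a = 0 → dotProduct ub b = 0 → dotProduct uc c = 0 →
        la * dotProduct ((dotProduct uc b) • ub - (dotProduct ub a) • uc) (crossProduct a ua) +
          lb * dotProduct ((dotProduct uc a) • ua - (dotProduct ua b) • uc) (crossProduct b ub) -
          lc * dotProduct ((dotProduct ua b) • ub + (dotProduct ub a) • ua) (crossProduct c uc) = 0) →
      la = lc ∧ lb = lc := by
  intro a b c la lb lc habc hab hA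
  obtain ⟨n, hn⟩ : ∃ n, crossProduct a b = n := ⟨_, rfl⟩
  -- scalar bookkeeping
  have hna : dotProduct n a = 0 := by rw [← hn, dotProduct_comm]; exact dot_self_cross a b
  have hnb : dotProduct n b = 0 := by rw [← hn, dotProduct_comm]; exact dot_cross_self a b
  have han : dotProduct a n = 0 := by rw [dotProduct_comm]; exact hna
  have hbn : dotProduct b n = 0 := by rw [dotProduct_comm]; exact hnb
  have hcn : dotProduct c n = 0 := by rw [← habc, add_dotProduct, han, hbn, add_zero]
  have hnc : dotProduct n c = 0 := by rw [dotProduct_comm]; exact hcn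
  have hνne : dotProduct n n ≠ 0 := fun h0 => hab (by rw [hn]; exact dotProduct_self_eq_zero.1 h0)
  have hA0 : dotProduct a a ≠ 0 := by
    intro h0
    have : a = 0 := dotProduct_self_eq_zero.1 h0
    exact hab (by rw [this, map_zero, LinearMap.zero_apply])
  have hC0 : dotProduct c c ≠ 0 := by
    intro h0
    have hc0 : c = 0 := dotProduct_self_eq_zero.1 h0
    have hb' : b = -a := by rw [← habc] at hc0; exact (neg_eq_of_add_eq_zero_right hc0).symm
    exact hab (by rw [hb', map_neg, cross_self, neg_zero])
  -- the triple product `n ⬝ (a × b) = n ⬝ n` in its various guises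
  have htba : dotProduct (crossProduct b n) a = dotProduct n n := by
    rw [dotProduct_comm, triple_product_permutation, triple_product_permutation, hn]
  have htab : dotProduct (crossProduct a n) b = -dotProduct n n := by
    rw [dotProduct_comm, triple_product_permutation, triple_product_permutation, ← cross_anticomm, hn,
      dotProduct_neg]
  have htca : dotProduct (crossProduct c n) a = dotProduct n n := by
    rw [dotProduct_comm, triple_product_permutation, triple_product_permutation, ← habc, map_add,
      cross_self, zero_add, hn]
  have htcb : dotProduct (crossProduct c n) b = -dotProduct n n := by
    rw [dotProduct_comm, triple_product_permutation, triple_product_permutation, ← habc, map_add,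
      cross_self, add_zero, ← cross_anticomm, hn, dotProduct_neg]
  -- transversality of the test vectors
  have hta : dotProduct (crossProduct a n) a = 0 := by rw [dotProduct_comm]; exact dot_self_cross a n
  have htb : dotProduct (crossProduct b n) b = 0 := by rw [dotProduct_comm]; exact dot_self_cross b n
  have htc : dotProduct (crossProduct c n) c = 0 := by rw [dotProduct_comm]; exact dot_self_cross c n
  -- double cross products and Lagrange
  have haa : crossProduct a (crossProduct a n) = -((dotProduct a a) • n) := by
    rw [cross_cross_eq_smul_sub_smul', han, zero_smul, zero_sub]
  have hbb : crossProduct b (crossProduct b n) = -((dotProduct b b) • n) := by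
    rw [cross_cross_eq_smul_sub_smul', hbn, zero_smul, zero_sub]
  have hcc : crossProduct c (crossProduct c n) = -((dotProduct c c) • n) := by
    rw [cross_cross_eq_smul_sub_smul', hcn, zero_smul, zero_sub]
  have lag : ∀ x y : Fin 3 → ℝ, dotProduct (crossProduct x n) (crossProduct y n) =
      dotProduct x y * dotProduct n n - dotProduct x n * dotProduct n y := fun x y => cross_dot_cross x n y n
  have hca' : dotProduct c a = dotProduct a a + dotProduct a b := by
    rw [← habc, add_dotProduct, dotProduct_comm b a]
  have hac' : dotProduct a c = dotProduct a a + dotProduct a b := by rw [dotProduct_comm]; exact hca'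
  have hcb' : dotProduct c b = dotProduct a b + dotProduct b b := by rw [← habc, add_dotProduct]
  have hbc' : dotProduct b c = dotProduct a b + dotProduct b b := by rw [dotProduct_comm]; exact hcb'
  have hcc' : dotProduct c c = dotProduct a a + 2 * dotProduct a b + dotProduct b b := by
    rw [← habc, add_dotProduct, dotProduct_add, dotProduct_add, dotProduct_comm b a]; ring
  -- the three identities
  have h5 := hA (crossProduct a n) (crossProduct b n) n hta htb hnc
  simp only [htba, htab, haa, hbb, zero_smul, zero_sub, sub_zero, zero_add, neg_smul,
    neg_dotProduct, dotProduct_neg, smul_dotProduct, dotProduct_smul, smul_eq_mul, add_dotProduct,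
    sub_neg_eq_add, lag, hbn, han, hna, hnb, hac', hbc', 
    zero_mul] at h5
  have h6 := hA (crossProduct a n) n (crossProduct c n) hta hnb htc
  simp only [htcb, htca, htab, haa, hcc, zero_smul, sub_zero, add_zero, neg_smul,
    neg_dotProduct, dotProduct_neg, smul_dotProduct, dotProduct_smul, smul_eq_mul, add_dotProduct,
    sub_neg_eq_add, lag, hcn, han, hna, hnb, hcb', hcc',
    mul_zero] at h6
  have h7 := hA n (crossProduct b n) (crossProduct c n) hna htb htc
  simp only [htcb, htba, htca, hbb, hcc, zero_smul, sub_zero, zero_add, neg_smul,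
    neg_dotProduct, dotProduct_neg, smul_dotProduct, dotProduct_smul, smul_eq_mul, 
    sub_dotProduct, lag, hbn, hcn, hna, hnb, hca', hcc',
    dotProduct_comm b a, mul_zero] at h7
  -- elimination
  have key1 : dotProduct n n ^ 2 * (2 * dotProduct a a * dotProduct c c) * (la - lc) = 0 := by
    rw [hcc']
    linear_combination (dotProduct b b) * h6 - (dotProduct a a) * h7 +
      (dotProduct a a + 2 * dotProduct a b + dotProduct b b) * h5
  have key2 : dotProduct n n ^ 2 * (2 * dotProduct b b * dotProduct c c) * (lb - lc) = 0 := by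
    rw [hcc']
    linear_combination (dotProduct b b) * h6 - (dotProduct a a) * h7 -
      (dotProduct a a + 2 * dotProduct a b + dotProduct b b) * h5
  have hB0 : dotProduct b b ≠ 0 := by
    intro h0
    have : b = 0 := dotProduct_self_eq_zero.1 h0
    exact hab (by rw [this, map_zero])
  have hν2 : dotProduct n n ^ 2 ≠ 0 := pow_ne_zero 2 hνne
  have h2AC : 2 * dotProduct a a * dotProduct c c ≠ 0 := mul_ne_zero (mul_ne_zero two_ne_zero hA0) hC0
  have h2BC : 2 * dotProduct b b * dotProduct c c ≠ 0 := mul_ne_zero (mul_ne_zero two_ne_zero hB0) hC0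
  refine ⟨sub_eq_zero.1 ?_, sub_eq_zero.1 ?_⟩
  · exact (mul_eq_zero.1 key1).resolve_left (mul_ne_zero hν2 h2AC)
  · exact (mul_eq_zero.1 key2).resolve_left (mul_ne_zero hν2 h2BC)

/-! ## Compressed antisymmetric blocks are multiples of `k × ·` -/

/-- **Axial representation of a compressed antisymmetric block.**  A real antisymmetric `3 × 3`
matrix `A` with `A k = 0`, `k ≠ 0`, acts as `w ↦ λ (k × w)` for the scalar
`λ = (ω·k)/|k|²`, `ω` the axial vector of `A`; hence `u ⬝ A w = λ u ⬝ (k × w)`. [folklore] -/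
theorem antisymm_rep (A : Matrix (Fin 3) (Fin 3) ℝ) (k : Fin 3 → ℝ) (hk : k ≠ 0)
    (hanti : Aᵀ = -A) (hAk : A *ᵥ k = 0) :
    ∃ lam : ℝ, ∀ u w : Fin 3 → ℝ, dotProduct u (A *ᵥ w) = lam * dotProduct u (crossProduct k w) := by
  have hent : ∀ i j, A j i = -A i j := fun i j => by
    have := congrFun (congrFun hanti i) j
    simpa using this
  set ω : Fin 3 → ℝ := ![A 2 1, A 0 2, A 1 0] with hω
  have hAw : ∀ w, A *ᵥ w = crossProduct ω w := by
    intro w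
    have h00 := hent 0 0
    have h11 := hent 1 1
    have h22 := hent 2 2
    have h01 := hent 1 0
    have h02 := hent 2 0
    have h12 := hent 2 1
    ext i
    fin_cases i
    · simp only [Matrix.mulVec, dotProduct, Fin.sum_univ_three, hω, cross_apply, Fin.isValue,
        Matrix.cons_val_zero, Matrix.cons_val_one, Matrix.cons_val_two, Matrix.head_cons, Matrix.tail_cons,
        Fin.zero_eta]
      linear_combination (w 0 / 2) * h00 + (w 1) * h01
    · simp only [Matrix.mulVec, dotProduct, Fin.sum_univ_three, hω, cross_apply, Fin.isValue,
        Matrix.cons_val_zero, Matrix.cons_val_one, Matrix.cons_val_two, Matrix.head_cons, Matrix.tail_cons,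
        Fin.mk_one]
      linear_combination (w 1 / 2) * h11 + (w 2) * h12
    · simp only [Matrix.mulVec, dotProduct, Fin.sum_univ_three, hω, cross_apply, Fin.isValue,
        Matrix.cons_val_zero, Matrix.cons_val_one, Matrix.cons_val_two, Matrix.head_cons, Matrix.tail_cons,
        Fin.reduceFinMk]
      linear_combination (w 2 / 2) * h22 + (w 0) * h02
  have hωk : crossProduct ω k = 0 := by rw [← hAw]; exact hAk
  have hkk : dotProduct k k ≠ 0 := fun h0 => hk (dotProduct_self_eq_zero.1 h0)
  refine ⟨dotProduct ω k / dotProduct k k, fun u w => ?_⟩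
  have hωeq : ω = (dotProduct ω k / dotProduct k k) • k := by
    have h := cross_cross_eq_smul_sub_smul' k ω k
    rw [hωk, map_zero] at h
    have h' : (dotProduct k k) • ω = (dotProduct ω k) • k := (sub_eq_zero.1 h.symm)
    rw [div_eq_inv_mul, mul_smul, ← h', smul_smul, inv_mul_cancel₀ hkk, one_smul]
  conv_lhs => rw [hAw, hωeq, LinearMap.map_smul₂, dotProduct_smul, smul_eq_mul]

end Summit.AnomalousDissipation.AnomalousDissipation.Theorems.MomentParityCubicParityLoud
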